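import Literature.NumberTheory.Automorphic.UnitaryLatticeTreeAxisCountTransport     -- ★ (z1-d) p847750; brings (z1-a) p847660∕p847701, (z1-b) p847645, Apartment, Defs
import Literature.NumberTheory.Automorphic.UnitaryLatticeTreeBlockGluing             -- ★ p847353 gluing
import Literature.NumberTheory.Automorphic.UnitaryLatticeTreeBlockSelfDualData       -- ★ p847272 (SD-W)∕(SD-e)
import HarnessLib

/-!
# The lattice graph of a hermitian space — THE TUBE COORDINATE of a self-dual lattice for a BLOCK form, the glue module, and the AXIS VERTEX `A(M) = (M ∩ W) + ϖ^b·M + 𝒪e₁`: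
# a block element `ι(γ₂, u)` fixing `M` fixes `A(M)` (Bruhat–Tits 1972 §10; Kottwitz 1986 §3; Jacobowitz 1962 §4; Serre, *Trees* II.1.1)

Topic `NumberTheory/Automorphic`; namespace `Literature.NumberTheory.Automorphic.UnitaryLatticeTree`.  THEOREMS ONLY (no definition, no instance, no notation, no named fact,
no `sorry`); kernel lane `--supports stmt-HodgeConjecture-24833`; datum-free (`K` with `Valued K ℤᵐ⁰`, `σ` valuation-preserving, `|ϖ| = exp(−1)`).  Cell `pub/hodgecm-mathlib`,
crux H413; road «S3-ram» (count-neutral), (T2) G-side organ (Cnt2′) of chair F0P3a-p07 (g14), sub-organ **(z1-c) TUBE LAYERS `b ≥ 1`** (ruling (3) 2026-09-02T02:14Z; census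
`F0/P3a/F0P2-p01/g16/z1c/CENSUS-z1c-TubeLayers.v1.F0P2p01g16.md`), part (c1-i)(c1-i′)(c1-ii)(c1-ii′)(c2)(c2′); the self-duality of `A(M)` and the gate property ((c1-iii)(c1-iv))
are the sequel `UnitaryLatticeTreeTubeAxisVertex`.  Seat F0P2-p01 (g16).
HONEST LABEL: HC_CM is proved only modulo the 2 remaining named inputs (hLiu418 24832, h413 24833) until rung 0 closes; elementary lattice algebra, no books consequence.

THE MATHEMATICS.  BLOCK CURRENCY of ★ `UnitaryLatticeTreeAxisEndoFrame[Basis]` ∕ `…AxisCountTransport`: `V = K³ = W ⊕ Ke₁`, `W = {x | x₁ = 0}` (coordinates `(0, 2 ∣ 1)`),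
form `H = !![H₂ 0 0, 0, H₂ 0 1; 0, h, 0; H₂ 1 0, 0, H₂ 1 1]` (`det H₂ ≠ 0`, `|h| = 1`), `pr_W x = x − x₁e₁`, block element `Γ = ι(γ₂, u) = endoGL (γ₂, u)`.  For a SELF-DUAL
lattice `M`:
* (c1-i) **TUBE COORDINATE** `b = b(M) : ℕ`: `c·e₁ ∈ M ⟺ |c| ≤ |ϖ|^b`, `|x₁| ≤ |ϖ|^{−b}` on `M` with equality somewhere — `M ∩ Ke₁ = ϖ^b𝒪e₁`, `pr₁ M = ϖ^{−b}𝒪` (★ (SD-e)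
  `single_mem_iff_forall_v_mul_le_one_of_block` + `pr₁ M` is the fractional ideal of the largest middle-row entry of a basis; `b ≥ 0` since `(pr₁M)⁻¹ ⊆ pr₁M`);
  (c1-i′) `b` is unique and `b = 0 ⟺ e₁ ∈ M` (AXIS); downstream heads carry the binder `hb : ∀ c, c·e₁ ∈ M ↔ |c| ≤ |ϖ|^b`.
* (c1-ii) the GLUE: for `x ∈ M`, `pr_W x ∈ M ⟺ |x₁| ≤ |ϖ|^b`; (c1-ii′) a GENERATOR `x₀ ∈ M` (`|x₀,₁| = |ϖ|^{−b}`) gives `M = (M ∩ W) + 𝒪x₀` (★ gluing §1) and, for `b ≥ 1`,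
  `c·pr_W x₀ ∈ M ⟺ |c| ≤ |ϖ|^{2b}` — the glue module `pr_W M ∕ (M ∩ W)` is cyclic of length `2b`, because `⟨x₀, x₀⟩ = ⟨pr_W x₀, pr_W x₀⟩ + σ(x₀,₁)·h·x₀,₁ ∈ 𝒪` forces
  `|⟨pr_W x₀, pr_W x₀⟩| = |ϖ|^{−2b}`.
* (c2) the AXIS VERTEX `A(M) := (M ∩ W) ⊔ ϖ^b·M ⊔ 𝒪e₁` (`= B(M) ⊕ 𝒪e₁`, `B(M) = (M ∩ W) + ϖ^b·pr_W M` the midpoint of `[M ∩ W, pr_W M]`): if `Γ·M = M` then `|u| = 1` and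
  **`Γ·A(M) = A(M)`** (`Γ` preserves `W`, commutes with `ϖ^b`, and `Γe₁ = u·e₁`); (c2′) with `A(M) = latt ι(g₂, 1)` (sequel (c1-iii′)): `γ₂·latt g₂ = latt g₂` (★ (z1-b) §2) — the
  fixed set off the axis is fibred over the `γ₂`-fixed self-dual `W`-lattices: `Fix(Γ) ∖ axis = ⊔_{b ≥ 1} ⊔_{B ∈ Fix_W(γ₂)} Cone_b(B)`.
* §0 bookkeeping: `|ϖ|^b = exp(−b)`, `|ϖ|^a ≤ |ϖ|^b ⟺ b ≤ a`, `(Γx)₁ = u·x₁`, `Γ(c e₁) = (uc)e₁`, the block shape of `H`.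

## References
* [BruhatTits1972] F. Bruhat, J. Tits, *Groupes réductifs sur un corps local I*, Publ. Math. IHÉS 41 (1972), §10 (lattice models; the building of a rank-one group is a tree).
* [Kottwitz1986] R. E. Kottwitz, *Base change for unit elements of Hecke algebras*, Compositio Math. 60 (1986), §3 (fixed lattices of a block element; reduction to Levi blocks).
* [Jacobowitz1962] R. Jacobowitz, *Hermitian forms over local fields*, Amer. J. Math. 84 (1962), §4 (dual lattices, gluing of modular components).
* [Rogawski1990] J. D. Rogawski, *Automorphic Representations of Unitary Groups in Three Variables*, Ann. of Math. Stud. 123 (1990), §4.8 Case (a) p. 53, §4.9 p. 55.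
* [Serre1980Trees] J.-P. Serre, *Trees* (1980), Ch. II §1.1 (lattices, distance from a base lattice).
-/

set_option autoImplicit false

noncomputable section

open scoped Valued WithZero Matrix MatrixGroups

namespace Literature.NumberTheory.Automorphic.UnitaryLatticeTree

open Literature.NumberTheory.Automorphic Literature.NumberTheory.Automorphic.HermitianLattice Literature.NumberTheory.Rogawski1990

variable {K : Type*} [Field K] [Valued K ℤᵐ⁰]

/-! ## §0 Valuation bookkeeping -/

/-- `|ϖ|^b = exp(−b)`. [cite: Serre1980Trees, Ch. II §1.1] -/
theorem v_pow_eq_exp_neg {ϖ : K} (hϖ : Valued.v ϖ = WithZero.exp (-1 : ℤ)) (b : ℕ) : Valued.v ϖ ^ b = WithZero.exp (-(b : ℤ)) := by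
  rw [hϖ, ← WithZero.exp_nsmul, smul_neg, nsmul_eq_mul, mul_one]

/-- `|ϖ|^a ≤ |ϖ|^b ⟺ b ≤ a`. [cite: Serre1980Trees, Ch. II §1.1] -/
theorem v_pow_le_v_pow_iff {ϖ : K} (hϖ : Valued.v ϖ = WithZero.exp (-1 : ℤ)) (a b : ℕ) : Valued.v ϖ ^ a ≤ Valued.v ϖ ^ b ↔ b ≤ a := by
  rw [v_pow_eq_exp_neg hϖ, v_pow_eq_exp_neg hϖ, WithZero.exp_le_exp]; omega

omit [Valued K ℤᵐ⁰] in
/-- The middle coordinate of `Γ x` for `Γ = ι(a, u)` is `u·x₁`. [cite: Rogawski1990, §4.8 Case (a) p. 53] -/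
theorem endoGL_mulVec_apply_one (a : GL (Fin 2) K) (u : GL (Fin 1) K) (x : Fin 3 → K) :
    (((endoGL (a, u) : GL (Fin 3) K) : Matrix (Fin 3) (Fin 3) K) *ᵥ x) 1 = (u : Matrix (Fin 1) (Fin 1) K) 0 0 * x 1 := by
  rw [coe_endoGL_eq_endoShape]
  simp [Matrix.mulVec, dotProduct, Fin.sum_univ_three]

omit [Valued K ℤᵐ⁰] in
/-- `Γ e₁ = u·e₁` for `Γ = ι(a, u)`. [cite: Rogawski1990, §4.8 Case (a) p. 53] -/
theorem endoGL_mulVec_single_one (a : GL (Fin 2) K) (u : GL (Fin 1) K) (c : K) :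
    ((endoGL (a, u) : GL (Fin 3) K) : Matrix (Fin 3) (Fin 3) K) *ᵥ Pi.single 1 c = Pi.single 1 ((u : Matrix (Fin 1) (Fin 1) K) 0 0 * c) := by
  rw [coe_endoGL_eq_endoShape]
  ext i; fin_cases i <;> simp [Matrix.mulVec, dotProduct, Fin.sum_univ_three]

/-! ## §1 (c1-i) the tube coordinate exists; (c1-i′) it is unique; (c1-ii) the glue -/

omit [Valued K ℤᵐ⁰] in
/-- The block form is block at `1`: column `1` vanishes off the diagonal. [cite: Rogawski1990, §4.8 Case (a) p. 53] -/
theorem endoShapeForm_col (H₂ : Matrix (Fin 2) (Fin 2) K) (h : K) (l : Fin 3) (hl : l ≠ 1) :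
    (!![H₂ 0 0, 0, H₂ 0 1; 0, h, 0; H₂ 1 0, 0, H₂ 1 1] : Matrix (Fin 3) (Fin 3) K) l 1 = 0 := by
  fin_cases l <;> simp at hl ⊢

omit [Valued K ℤᵐ⁰] in
/-- The block form is block at `1`: row `1` vanishes off the diagonal. [cite: Rogawski1990, §4.8 Case (a) p. 53] -/
theorem endoShapeForm_row (H₂ : Matrix (Fin 2) (Fin 2) K) (h : K) (l : Fin 3) (hl : l ≠ 1) :
    (!![H₂ 0 0, 0, H₂ 0 1; 0, h, 0; H₂ 1 0, 0, H₂ 1 1] : Matrix (Fin 3) (Fin 3) K) 1 l = 0 := by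
  fin_cases l <;> simp at hl ⊢

omit [Valued K ℤᵐ⁰] in
/-- The middle entry of the block form is `h`. [cite: Rogawski1990, §4.8 Case (a) p. 53] -/
theorem endoShapeForm_one_one (H₂ : Matrix (Fin 2) (Fin 2) K) (h : K) :
    (!![H₂ 0 0, 0, H₂ 0 1; 0, h, 0; H₂ 1 0, 0, H₂ 1 1] : Matrix (Fin 3) (Fin 3) K) 1 1 = h := rfl

/-- The block form is invertible when `det H₂ ≠ 0` and `|h| = 1`. [cite: Rogawski1990, §4.8 Case (a) p. 53] -/
theorem isUnit_det_endoShapeForm {H₂ : Matrix (Fin 2) (Fin 2) K} (hH₂ : IsUnit H₂.det) {h : K} (hh : Valued.v h = 1) :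
    IsUnit (!![H₂ 0 0, 0, H₂ 0 1; 0, h, 0; H₂ 1 0, 0, H₂ 1 1] : Matrix (Fin 3) (Fin 3) K).det := by
  have hh0 : h ≠ 0 := fun h0 => by rw [h0, map_zero] at hh; exact zero_ne_one hh
  rw [det_endoShape]; exact hH₂.mul (isUnit_iff_ne_zero.2 hh0)

/-- The middle coordinate on `latt g` is bounded by the largest middle-row entry of `g`, and the bound is attained at a column. [cite: Serre1980Trees, Ch. II §1.1] -/
theorem exists_coord_one_bound (g : GL (Fin 3) K) :
    ∃ c₀ : K, c₀ ≠ 0 ∧ (∀ x ∈ latt (g : Matrix (Fin 3) (Fin 3) K), Valued.v (x 1) ≤ Valued.v c₀) ∧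
      ∃ x ∈ latt (g : Matrix (Fin 3) (Fin 3) K), x 1 = c₀ := by
  obtain ⟨j₀, -, hj₀⟩ := Finset.exists_max_image Finset.univ (fun j => Valued.v ((g : Matrix (Fin 3) (Fin 3) K) 1 j)) Finset.univ_nonempty
  refine ⟨(g : Matrix (Fin 3) (Fin 3) K) 1 j₀, ?_, ?_, ?_⟩
  · intro h0
    have hrow : ∀ j, (g : Matrix (Fin 3) (Fin 3) K) 1 j = 0 := fun j => by
      have hj := hj₀ j (Finset.mem_univ j)
      rw [h0, map_zero, le_zero_iff] at hj
      exact (Valuation.zero_iff _).1 hj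
    exact (Matrix.isUnits_det_units g).ne_zero (Matrix.det_eq_zero_of_row_eq_zero 1 hrow)
  · intro x hx
    rw [latt, Submodule.mem_map] at hx
    obtain ⟨u, hu, rfl⟩ := hx
    rw [LinearMap.restrictScalars_apply, Matrix.toLin'_apply]
    change Valued.v (∑ j, (g : Matrix (Fin 3) (Fin 3) K) 1 j * u j) ≤ _
    refine Valuation.map_sum_le _ fun j _ => ?_
    rw [map_mul]
    exact (mul_le_mul' (hj₀ j (Finset.mem_univ j)) ((mem_stdLattice).1 hu j)).trans (le_of_eq (mul_one _))
  · refine ⟨(g : Matrix (Fin 3) (Fin 3) K) *ᵥ Pi.single j₀ 1, mulVec_single_mem_latt _ j₀, ?_⟩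
    simp [Matrix.mulVec, dotProduct, Pi.single_apply]

/-- **(c1-i) TUBE COORDINATE.** For a self-dual `M` (block form): there is `b : ℕ` with `c·e₁ ∈ M ⟺ |c| ≤ |ϖ|^b`, `|x₁|·|ϖ|^b ≤ 1` on `M`, and `|x₁|·|ϖ|^b = 1` for some `x ∈ M`
(so `M ∩ Ke₁ = ϖ^b𝒪e₁`, `pr₁ M = ϖ^{-b}𝒪`: ★ (SD-e) + `pr₁ M` is the fractional ideal of the largest middle coordinate; `b ≥ 0` because `(pr₁ M)⁻¹ ⊆ pr₁ M`).
[cite: Jacobowitz1962, §4] [cite: BruhatTits1972, §10] -/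
theorem exists_tubeCoordinate (σ : K →+* K) (hvσ : ∀ a, Valued.v (σ a) = Valued.v a) {ϖ : K} (hϖ : Valued.v ϖ = WithZero.exp (-1 : ℤ))
    {H₂ : Matrix (Fin 2) (Fin 2) K} (hH₂ : IsUnit H₂.det) {h : K} (hh : Valued.v h = 1)
    {M : Submodule 𝒪[K] (Fin 3 → K)} (hM : IsSelfDualLattice σ ϖ (!![H₂ 0 0, 0, H₂ 0 1; 0, h, 0; H₂ 1 0, 0, H₂ 1 1] : Matrix (Fin 3) (Fin 3) K) M) :
    ∃ b : ℕ, (∀ c : K, (Pi.single 1 c : Fin 3 → K) ∈ M ↔ Valued.v c ≤ Valued.v ϖ ^ b) ∧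
      (∀ x ∈ M, Valued.v (x 1) * Valued.v ϖ ^ b ≤ 1) ∧ (∃ x ∈ M, Valued.v (x 1) * Valued.v ϖ ^ b = 1) := by
  have hSDe := single_mem_iff_forall_v_mul_le_one_of_block hvσ (ϖ := ϖ) 1 (fun l hl => endoShapeForm_col H₂ h l hl)
    (by rw [endoShapeForm_one_one]; exact hh) (isUnit_det_endoShapeForm hH₂ hh) hM
  obtain ⟨g, hMg, -, -, -⟩ := id hM
  obtain ⟨c₀, hc₀, hbound, x₁, hx₁, hx₁1⟩ := exists_coord_one_bound g
  rw [← hMg] at hbound hx₁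
  have hvc₀ : Valued.v c₀ ≠ 0 := (Valuation.ne_zero_iff _).2 hc₀
  have hpos : 0 < Valued.v c₀ := zero_lt_iff.2 hvc₀
  -- `c e₁ ∈ M ⟺ |c₀|·|c| ≤ 1`
  have hiff : ∀ c : K, (Pi.single 1 c : Fin 3 → K) ∈ M ↔ Valued.v c₀ * Valued.v c ≤ 1 := fun c => by
    rw [hSDe]
    constructor
    · intro hc; have := hc x₁ hx₁; rwa [hx₁1] at this
    · intro hc m hm; exact (mul_le_mul' (hbound m hm) le_rfl).trans hc
  -- `1 ≤ |c₀|`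
  have hone : 1 ≤ Valued.v c₀ := by
    have hmem : (Pi.single 1 c₀⁻¹ : Fin 3 → K) ∈ M := (hiff _).2 (by rw [map_inv₀, mul_inv_cancel₀ hvc₀])
    have hle : (Valued.v c₀)⁻¹ ≤ Valued.v c₀ := by have := hbound _ hmem; rwa [Pi.single_eq_same, map_inv₀] at this
    by_contra hlt
    rw [not_le] at hlt
    exact lt_irrefl _ ((hlt.trans (one_lt_inv_iff₀.2 ⟨hpos, hlt⟩)).trans_le hle)
  -- `|c₀| = exp n`, `n ≥ 0`, `b := n`
  set n : ℤ := WithZero.log (Valued.v c₀) with hn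
  have hexp : Valued.v c₀ = WithZero.exp n := (WithZero.exp_log hvc₀).symm
  have hn0 : 0 ≤ n := by rw [hexp, ← WithZero.exp_zero, WithZero.exp_le_exp] at hone; exact hone
  have hb : Valued.v ϖ ^ n.toNat = (Valued.v c₀)⁻¹ := by
    rw [v_pow_eq_exp_neg hϖ, Int.toNat_of_nonneg hn0, hexp, WithZero.exp_neg]
  refine ⟨n.toNat, ?_, ?_, ?_⟩
  · intro c
    rw [hiff, hb, ← le_inv_mul_iff₀ hpos, mul_one]
  · intro x hx
    rw [hb]
    calc Valued.v (x 1) * (Valued.v c₀)⁻¹ ≤ Valued.v c₀ * (Valued.v c₀)⁻¹ := mul_le_mul' (hbound x hx) le_rfl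
      _ = 1 := mul_inv_cancel₀ hvc₀
  · exact ⟨x₁, hx₁, by rw [hb, hx₁1, mul_inv_cancel₀ hvc₀]⟩



/-- (c1-i′) The tube coordinate is unique, and `b = 0` iff `e₁ ∈ M` (AXIS). [cite: BruhatTits1972, §10] -/
theorem tubeCoordinate_unique {ϖ : K} (hϖ : Valued.v ϖ = WithZero.exp (-1 : ℤ)) {M : Submodule 𝒪[K] (Fin 3 → K)} {b b' : ℕ}
    (hb : ∀ c : K, (Pi.single 1 c : Fin 3 → K) ∈ M ↔ Valued.v c ≤ Valued.v ϖ ^ b) (hb' : ∀ c : K, (Pi.single 1 c : Fin 3 → K) ∈ M ↔ Valued.v c ≤ Valued.v ϖ ^ b') :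
    b = b' ∧ ((Pi.single 1 1 : Fin 3 → K) ∈ M ↔ b = 0) := by
  have key : ∀ {a a' : ℕ}, (∀ c : K, (Pi.single 1 c : Fin 3 → K) ∈ M ↔ Valued.v c ≤ Valued.v ϖ ^ a) →
      (∀ c : K, (Pi.single 1 c : Fin 3 → K) ∈ M ↔ Valued.v c ≤ Valued.v ϖ ^ a') → a' ≤ a := fun {a a'} h h' => by
    have h1 : Valued.v (ϖ ^ a) ≤ Valued.v ϖ ^ a' := (h' (ϖ ^ a)).1 ((h (ϖ ^ a)).2 (by rw [map_pow]))
    rw [map_pow, v_pow_le_v_pow_iff hϖ] at h1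
    exact h1
  refine ⟨le_antisymm (key hb' hb) (key hb hb'), ?_⟩
  rw [hb 1, map_one, ← pow_zero (Valued.v ϖ), v_pow_le_v_pow_iff hϖ]
  omega

/-- (c1-ii) For `x ∈ M`: `pr_W x ∈ M ⟺ x₁e₁ ∈ M ⟺ |x₁| ≤ |ϖ|^b`. [cite: BruhatTits1972, §10] -/
theorem sub_single_mem_iff_of_tubeCoordinate {ϖ : K} {M : Submodule 𝒪[K] (Fin 3 → K)} {b : ℕ}
    (hb : ∀ c : K, (Pi.single 1 c : Fin 3 → K) ∈ M ↔ Valued.v c ≤ Valued.v ϖ ^ b) {x : Fin 3 → K} (hx : x ∈ M) :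
    x - Pi.single 1 (x 1) ∈ M ↔ Valued.v (x 1) ≤ Valued.v ϖ ^ b := by
  rw [← hb]
  constructor
  · intro h
    have h' := M.sub_mem hx h
    rwa [sub_sub_cancel] at h'
  · intro h
    exact M.sub_mem hx h

/-- (c1-ii′) **GENERATION AND THE GLUE MODULE.**  For a self-dual `M` with tube coordinate `b ≥ 1`: a generator `x₀ ∈ M` (`|x₀,₁|·|ϖ|^b = 1`) gives `M = (M ∩ W) + 𝒪x₀`
(★ gluing §1), and `c·pr_W x₀ ∈ M ⟺ |c| ≤ |ϖ|^{2b}` — the glue module `pr_W M ∕ (M ∩ W)` is cyclic of length `2b` (the generator's W-part has norm of size `|ϖ|^{-2b}`: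
`⟨x₀,x₀⟩ = ⟨pr x₀, pr x₀⟩ + σ(x₀,₁)·h·x₀,₁ ∈ 𝒪`). [cite: Jacobowitz1962, §4] [cite: BruhatTits1972, §10] -/
theorem exists_smul_add_of_tubeCoordinate (σ : K →+* K) (hvσ : ∀ a, Valued.v (σ a) = Valued.v a) {ϖ : K} (hϖ : Valued.v ϖ = WithZero.exp (-1 : ℤ))
    {H₂ : Matrix (Fin 2) (Fin 2) K} {h : K} (hh : Valued.v h = 1)
    {M : Submodule 𝒪[K] (Fin 3 → K)} (hM : IsSelfDualLattice σ ϖ (!![H₂ 0 0, 0, H₂ 0 1; 0, h, 0; H₂ 1 0, 0, H₂ 1 1] : Matrix (Fin 3) (Fin 3) K) M) {b : ℕ} (hb1 : 1 ≤ b)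
    (hb : ∀ c : K, (Pi.single 1 c : Fin 3 → K) ∈ M ↔ Valued.v c ≤ Valued.v ϖ ^ b) (hpr : ∀ x ∈ M, Valued.v (x 1) * Valued.v ϖ ^ b ≤ 1)
    {x₀ : Fin 3 → K} (hx₀ : x₀ ∈ M) (hx₀1 : Valued.v (x₀ 1) * Valued.v ϖ ^ b = 1) :
    (∀ x ∈ M, ∃ (c : K) (w : Fin 3 → K), Valued.v c ≤ 1 ∧ w ∈ M ∧ w 1 = 0 ∧ x = c • x₀ + w) ∧
      (∀ c : K, c • (x₀ - Pi.single 1 (x₀ 1)) ∈ M ↔ Valued.v c ≤ Valued.v ϖ ^ (2 * b)) := by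
  set H : Matrix (Fin 3) (Fin 3) K := !![H₂ 0 0, 0, H₂ 0 1; 0, h, 0; H₂ 1 0, 0, H₂ 1 1] with hHdef
  have hHcol : ∀ l : Fin 3, l ≠ 1 → H l 1 = 0 := fun l hl => endoShapeForm_col H₂ h l hl
  have hHrow : ∀ l : Fin 3, l ≠ 1 → H 1 l = 0 := fun l hl => endoShapeForm_row H₂ h l hl
  have hH11 : H 1 1 = h := endoShapeForm_one_one H₂ h
  have hϖ0 : Valued.v ϖ ≠ 0 := by rw [hϖ]; exact WithZero.exp_ne_zero
  have hϖb0 : Valued.v ϖ ^ b ≠ 0 := pow_ne_zero _ hϖ0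
  have hpos : 0 < Valued.v ϖ ^ b := zero_lt_iff.2 hϖb0
  have hx₀v : Valued.v (x₀ 1) = (Valued.v ϖ ^ b)⁻¹ := eq_inv_of_mul_eq_one_left hx₀1
  have hx₀10 : x₀ 1 ≠ 0 := fun h0 => by rw [h0, map_zero, zero_mul] at hx₀1; exact zero_ne_one hx₀1
  -- every middle coordinate is bounded by the generator's
  have hmax : ∀ m ∈ M, Valued.v (m 1) ≤ Valued.v (x₀ 1) := fun m hm => by
    rw [hx₀v, ← one_mul (Valued.v ϖ ^ b)⁻¹, le_mul_inv_iff₀ hpos]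
    exact hpr m hm
  refine ⟨fun x hx => ?_, fun c => ?_⟩
  · obtain ⟨t, ht, htM, ht1⟩ := (mem_iff_exists_sub_smul_mem_of_coord_le 1 hx₀ hx₀10 hmax x).1 hx
    exact ⟨t, x - t • x₀, ht, htM, ht1, (add_sub_cancel (t • x₀) x).symm⟩
  · -- the W-part `w₀ = pr_W x₀` of the generator has norm of size `|ϖ|^{-2b}`
    have hw1 : (x₀ - Pi.single 1 (x₀ 1) : Fin 3 → K) 1 = 0 := by simp
    have hMd : M ≤ dualLatt σ H M := le_dualLatt_of_isVertexLattice hvσ hM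
    have hself : Valued.v (pairing σ H x₀ x₀) ≤ 1 := (mem_dualLatt σ H M x₀).1 (hMd hx₀) x₀ hx₀
    have hwx : pairing σ H (x₀ - Pi.single 1 (x₀ 1)) (x₀ - Pi.single 1 (x₀ 1)) = pairing σ H (x₀ - Pi.single 1 (x₀ 1)) x₀ := by
      rw [pairing_sub_single_right_of_block σ H 1 hHcol, hw1, map_zero, zero_mul, zero_mul, sub_zero]
    have hww : pairing σ H (x₀ - Pi.single 1 (x₀ 1)) (x₀ - Pi.single 1 (x₀ 1)) = pairing σ H x₀ x₀ - σ (x₀ 1) * h * x₀ 1 := by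
      rw [pairing_sub_single_left_of_block σ H 1 hHrow x₀ hw1, pairing_sub_single_right_of_block σ H 1 hHcol x₀ x₀, hH11]
    have hbig : Valued.v (σ (x₀ 1) * h * x₀ 1) = (Valued.v ϖ ^ b)⁻¹ * (Valued.v ϖ ^ b)⁻¹ := by
      rw [map_mul, map_mul, hvσ, hh, mul_one, hx₀v]
    have hlt1 : Valued.v ϖ ^ b < 1 := by
      rw [← pow_zero (Valued.v ϖ), v_pow_eq_exp_neg hϖ, v_pow_eq_exp_neg hϖ, WithZero.exp_lt_exp]; omega
    have hinv1 : 1 < (Valued.v ϖ ^ b)⁻¹ := one_lt_inv_iff₀.2 ⟨hpos, hlt1⟩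
    have hgt : Valued.v (pairing σ H x₀ x₀) < Valued.v (σ (x₀ 1) * h * x₀ 1) := by
      rw [hbig]; exact lt_of_le_of_lt hself (one_lt_mul_of_lt_of_le hinv1 hinv1.le)
    have hvww : Valued.v (pairing σ H (x₀ - Pi.single 1 (x₀ 1)) (x₀ - Pi.single 1 (x₀ 1))) = (Valued.v ϖ ^ b)⁻¹ * (Valued.v ϖ ^ b)⁻¹ := by
      rw [hww, Valuation.map_sub_eq_of_lt_right _ hgt, hbig]
    constructor
    · intro hc
      have h1 := (mem_dualLatt σ H M x₀).1 (hMd hx₀) _ hc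
      rw [map_smulₛₗ, LinearMap.smul_apply, smul_eq_mul, map_mul, hvσ, ← hwx, hvww] at h1
      have h2 := mul_le_mul' h1 (le_refl (Valued.v ϖ ^ b * Valued.v ϖ ^ b))
      rw [mul_assoc, mul_mul_mul_comm, inv_mul_cancel₀ hϖb0, one_mul, mul_one, one_mul] at h2
      rwa [two_mul, pow_add]
    · intro hc
      have hϖ1 : Valued.v ϖ ≤ 1 := by rw [hϖ, ← WithZero.exp_zero, WithZero.exp_le_exp]; omega
      have hc1 : Valued.v c ≤ 1 := hc.trans (pow_le_one₀ zero_le hϖ1)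
      have e : c • (x₀ - Pi.single 1 (x₀ 1)) = c • x₀ - Pi.single 1 (c * x₀ 1) := by
        ext k
        rcases eq_or_ne k 1 with rfl | hk
        · simp
        · simp [hk]
      rw [e]
      refine M.sub_mem (smul_mem_of_v_le M hc1 hx₀) ((hb _).2 ?_)
      rw [map_mul, hx₀v, mul_inv_le_iff₀ hpos, ← pow_add, ← two_mul]
      exact hc

/-! ## §2 (c2) fixedness descends to the axis vertex -/

/-- One direction of (c2): `Γ·M ≤ M` with `|u| ≤ 1` gives `Γ·A(M) ≤ A(M)`. [cite: Kottwitz1986, §3] [cite: BruhatTits1972, §10] -/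
theorem mapGL_axisVertex_le_of_mapGL_le {ϖ : K} {M : Submodule 𝒪[K] (Fin 3 → K)} (b : ℕ)
    (γ₂ : GL (Fin 2) K) (u : GL (Fin 1) K) (hu : Valued.v ((u : Matrix (Fin 1) (Fin 1) K) 0 0) ≤ 1) (hfix : mapGL (endoGL (γ₂, u)) M ≤ M) :
    mapGL (endoGL (γ₂, u)) (M ⊓ LinearMap.ker ((LinearMap.proj (1 : Fin 3) : (Fin 3 → K) →ₗ[K] K).restrictScalars 𝒪[K]) ⊔ scaleLattice (ϖ ^ b) M ⊔ Submodule.span 𝒪[K] {(Pi.single 1 1 : Fin 3 → K)}) ≤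
      M ⊓ LinearMap.ker ((LinearMap.proj (1 : Fin 3) : (Fin 3 → K) →ₗ[K] K).restrictScalars 𝒪[K]) ⊔ scaleLattice (ϖ ^ b) M ⊔ Submodule.span 𝒪[K] {(Pi.single 1 1 : Fin 3 → K)} := by
  rw [mapGL, Submodule.map_sup, Submodule.map_sup]
  refine sup_le (sup_le ?_ ?_) ?_
  · -- the W-part
    refine le_trans ?_ (le_sup_of_le_left le_sup_left)
    rintro _ ⟨x, ⟨hxM, hxW⟩, rfl⟩
    refine ⟨hfix ⟨x, hxM, rfl⟩, ?_⟩
    change (((endoGL (γ₂, u) : GL (Fin 3) K) : Matrix (Fin 3) (Fin 3) K) *ᵥ x) 1 = 0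
    have hx1 : x 1 = 0 := hxW
    rw [endoGL_mulVec_apply_one, hx1, mul_zero]
  · -- the scaled part
    refine le_trans ?_ (le_sup_of_le_left le_sup_right)
    change mapGL (endoGL (γ₂, u)) (scaleLattice (ϖ ^ b) M) ≤ scaleLattice (ϖ ^ b) M
    rw [mapGL_scaleLattice]
    exact Submodule.map_mono hfix
  · -- the line
    refine le_trans ?_ le_sup_right
    rw [Submodule.map_span, Submodule.span_le, Set.image_singleton, Set.singleton_subset_iff]
    change (((endoGL (γ₂, u) : GL (Fin 3) K) : Matrix (Fin 3) (Fin 3) K) *ᵥ Pi.single 1 1) ∈ _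
    rw [endoGL_mulVec_single_one, mul_one]
    have e : (Pi.single 1 ((u : Matrix (Fin 1) (Fin 1) K) 0 0) : Fin 3 → K) =
        (⟨(u : Matrix (Fin 1) (Fin 1) K) 0 0, (mem_integer_iff' _).2 hu⟩ : 𝒪[K]) • (Pi.single 1 1 : Fin 3 → K) := by
      ext i
      change _ = (((u : Matrix (Fin 1) (Fin 1) K) 0 0) • (Pi.single 1 1 : Fin 3 → K)) i
      by_cases hi : i = 1
      · subst hi; simp
      · simp [hi]
    rw [SetLike.mem_coe, e]
    exact Submodule.smul_mem _ _ (Submodule.mem_span_singleton_self _)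

/-- Cancellation in `ℤᵐ⁰`: `x·c ≤ c` with `c ≠ 0` forces `x ≤ 1`. [cite: Serre1980Trees, Ch. II §1.1] -/
theorem le_one_of_mul_le_self {x c : ℤᵐ⁰} (hc : c ≠ 0) (h : x * c ≤ c) : x ≤ 1 := by
  have h' : x * c * c⁻¹ ≤ c * c⁻¹ := mul_le_mul' h le_rfl
  rwa [mul_assoc, mul_inv_cancel₀ hc, mul_one] at h'

/-- **(c2) A FIXED LATTICE HAS A FIXED AXIS VERTEX.**  `Γ = ι(γ₂, u)`; if `Γ·M = M` then `|u| = 1`, `Γ` fixes `M ∩ W`, `ϖ^b·M` and `e₁·𝒪`, hence `A(M)`; and the W-index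
`latt g₂` of `A(M) = latt ι(g₂,1)` is `γ₂`-fixed (★ (z1-b) §2). [cite: Kottwitz1986, §3] [cite: BruhatTits1972, §10] -/
theorem mapGL_axisVertex_eq_of_mapGL_eq {ϖ : K} (hϖ : Valued.v ϖ = WithZero.exp (-1 : ℤ)) {M : Submodule 𝒪[K] (Fin 3 → K)}
    {b : ℕ} (hb : ∀ c : K, (Pi.single 1 c : Fin 3 → K) ∈ M ↔ Valued.v c ≤ Valued.v ϖ ^ b)
    (γ₂ : GL (Fin 2) K) (u : GL (Fin 1) K) (hfix : mapGL (endoGL (γ₂, u)) M = M) :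
    Valued.v ((u : Matrix (Fin 1) (Fin 1) K) 0 0) = 1 ∧
    mapGL (endoGL (γ₂, u)) (M ⊓ LinearMap.ker ((LinearMap.proj (1 : Fin 3) : (Fin 3 → K) →ₗ[K] K).restrictScalars 𝒪[K]) ⊔ scaleLattice (ϖ ^ b) M ⊔ Submodule.span 𝒪[K] {(Pi.single 1 1 : Fin 3 → K)}) =
      M ⊓ LinearMap.ker ((LinearMap.proj (1 : Fin 3) : (Fin 3 → K) →ₗ[K] K).restrictScalars 𝒪[K]) ⊔ scaleLattice (ϖ ^ b) M ⊔ Submodule.span 𝒪[K] {(Pi.single 1 1 : Fin 3 → K)} := by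
  have hΓinv : endoGL (γ₂⁻¹, u⁻¹) = (endoGL (γ₂, u))⁻¹ := by rw [← map_inv, Prod.inv_mk]
  -- the inverse also fixes `M`
  have hfix' : mapGL (endoGL (γ₂⁻¹, u⁻¹)) M = M := by
    rw [hΓinv]
    conv_lhs => rw [← hfix]
    rw [← mapGL_mul, inv_mul_cancel, mapGL_one]
  -- `|u| ≤ 1` and `|u⁻¹| ≤ 1`
  have hϖb : (Pi.single 1 (ϖ ^ b) : Fin 3 → K) ∈ M := (hb _).2 (by rw [map_pow])
  have hc0 : Valued.v ϖ ^ b ≠ 0 := pow_ne_zero _ (by rw [hϖ]; exact WithZero.exp_ne_zero)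
  have hule : ∀ (γ' : GL (Fin 2) K) (u' : GL (Fin 1) K), mapGL (endoGL (γ', u')) M = M → Valued.v ((u' : Matrix (Fin 1) (Fin 1) K) 0 0) ≤ 1 := by
    intro γ' u' h
    have hmem : (((endoGL (γ', u') : GL (Fin 3) K) : Matrix (Fin 3) (Fin 3) K) *ᵥ Pi.single 1 (ϖ ^ b)) ∈ M := by
      rw [← h]; exact ⟨_, hϖb, rfl⟩
    rw [endoGL_mulVec_single_one, hb, map_mul, map_pow] at hmem
    exact le_one_of_mul_le_self hc0 hmem
  have hu : Valued.v ((u : Matrix (Fin 1) (Fin 1) K) 0 0) ≤ 1 := hule γ₂ u hfix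
  have hu' : Valued.v (((u⁻¹ : GL (Fin 1) K) : Matrix (Fin 1) (Fin 1) K) 0 0) ≤ 1 := hule γ₂⁻¹ u⁻¹ hfix'
  refine ⟨(v_le_one_and_v_inv_le_one_iff u).1 ⟨hu, hu'⟩, le_antisymm (mapGL_axisVertex_le_of_mapGL_le b γ₂ u hu hfix.le) ?_⟩
  have h' := mapGL_axisVertex_le_of_mapGL_le (ϖ := ϖ) (M := M) b γ₂⁻¹ u⁻¹ hu' hfix'.le
  have h'' := (mapGL_le_mapGL_iff (endoGL (γ₂, u)) _ _).2 h'
  rwa [← mapGL_mul, hΓinv, mul_inv_cancel, mapGL_one] at h''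

/-- (c2′) W-SIDE: with `A(M) = latt ι(g₂, 1)`, `Γ·M = M ⇒ γ₂·latt g₂ = latt g₂` (★ (z1-b) §2 `mapGL_endoGL_latt_endoGL_eq_iff`). [cite: Kottwitz1986, §3] -/
theorem mapGL_latt_eq_of_axisVertex_eq {ϖ : K} (hϖ : Valued.v ϖ = WithZero.exp (-1 : ℤ)) {M : Submodule 𝒪[K] (Fin 3 → K)}
    {b : ℕ} (hb : ∀ c : K, (Pi.single 1 c : Fin 3 → K) ∈ M ↔ Valued.v c ≤ Valued.v ϖ ^ b)
    (γ₂ : GL (Fin 2) K) (u : GL (Fin 1) K) (hfix : mapGL (endoGL (γ₂, u)) M = M) (g₂ : GL (Fin 2) K)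
    (hA : latt ((endoGL (g₂, (1 : GL (Fin 1) K)) : GL (Fin 3) K) : Matrix (Fin 3) (Fin 3) K) =
      M ⊓ LinearMap.ker ((LinearMap.proj (1 : Fin 3) : (Fin 3 → K) →ₗ[K] K).restrictScalars 𝒪[K]) ⊔ scaleLattice (ϖ ^ b) M ⊔ Submodule.span 𝒪[K] {(Pi.single 1 1 : Fin 3 → K)}) :
    mapGL γ₂ (latt (g₂ : Matrix (Fin 2) (Fin 2) K)) = latt (g₂ : Matrix (Fin 2) (Fin 2) K) := by
  have h := (mapGL_axisVertex_eq_of_mapGL_eq hϖ hb γ₂ u hfix).2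
  rw [← hA, mapGL_endoGL_latt_endoGL_eq_iff] at h
  exact h.1

end Literature.NumberTheory.Automorphic.UnitaryLatticeTree

end
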